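import Summits.CriticalPhenomena.SAWScalingLimit.Theses.SAWBetheAnsatz
import Summits.CriticalPhenomena.SAWScalingLimit.Theorems.SAWLoopFugacityFlowAvoidanceDeterminesLaw
import Summits.CriticalPhenomena.SAWScalingLimit.Theorems.SAWLoopFugacityFlowSLECarrier
import Summits.CriticalPhenomena.SAWScalingLimit.Theorems.SAWSteinDefectSLEAvoidanceValue
import Literature.Probability.RandomPlanarGeometry.SLEExistenceNeEightHolds
import Literature.Probability.RandomPlanarGeometry.CaratheodoryHalfPlaneProofs
import Literature.Probability.RandomPlanarGeometry.RestrictionHullsRiemannProofs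
import Literature.Probability.RandomPlanarGeometry.RestrictionHullsProofs
import Literature.Probability.RandomPlanarGeometry.HullSubdomainPullback
import Literature.Probability.RandomPlanarGeometry.JordanDomainProofs

/-!
# Line `birth` — registered skeleton for the crux `HexSubseqIdentification` (stmt-CriticalPhenomena-4998)

Crux (FIXED; rank 5 of `route-CriticalPhenomena-SAWBetheAnsatz`, decl
`Summit.CriticalPhenomena.SAWScalingLimit.Theses.SAWBetheAnsatz.HexSubseqIdentification`):
Duminil-Copin–Smirnov's Conjecture 1 MINUS precompactness — for every Dobrushin domain `(D; a, b)`,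
every hexagonal endpoint approximation `(a_δ, b_δ)`, every sequence `s_n → 0⁺` and every probability
measure `ν` on `CurveClass ℂ`: if the critical hexagonal SAW laws `hexSAWLaw D (s n) (a (s n)) (b (s n))`
pushed to curve classes converge weakly to `ν` (bounded continuous test functions), then `ν` IS the
chordal SLE_{8/3} law of `D` (`IsSLELaw (8/3) D ν`).

The route's own words for this crux: "inputs foreseen: … restriction programmes on Hex (sibling routes),
with r2's `x̃₁ = 5/8` as the independently computed boundary exponent". This skeleton is exactly that
restriction programme, cut along Lawler–Schramm–Werner's theorem that a chordal law carried by simple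
curves is determined by its hull-avoidance probabilities, whose SLE_{8/3} values are `Φ'_A(0)^{5/8}`
(LSW03 arXiv:math/0209343: Lemma 3.2 p. 10, Prop. 3.3 pp. 10–11, Thm. 6.1 p. 23) — and it rests on what
the tree has ALREADY PROVED of that programme:

* `Theorems.AvoidanceDeterminesLaw.AvoidanceDeterminesLaw_proof` (item stmt-CriticalPhenomena-1373,
  PROVED): two probability measures on `CurveClass ℂ` carried by simple chords of `D` from `a` to `b`
  meeting `∂D` only at `a, b` which give the same mass to `{range ⊆ closure D'}` for every hull subdomain
  `D'` (ε-ball form) are EQUAL;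
* `Theorems.SLECarrier_proof` (stmt-CriticalPhenomena-4985, PROVED): the chordal SLE_{8/3} law of `D` is a
  probability measure so carried (Rohde–Schramm simplicity, transience, boundary avoidance);
* `Theorems.SLEAvoidanceValue_pullbackHull_proof` (stmt-CriticalPhenomena-4986, PROVED): LSW03 Thm. 6.1
  transposed — `μ_SLE {range ⊆ closure D'} = Φ'_A(0)^{5/8}` for `A = φ.pullbackHull D'`;
* `exists_isSLECurve_eightThirds` (the SLE_{8/3} law exists), `MarkedDomain.exists_isChordalUniformizing_holds`
  (chordal uniformizers exist), `IsStarHull.pullbackHull` + `JordanDomain.isSimplyConnected_holds`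
  (pulled-back hulls of hull subdomains are `*`-hulls), `IsStarHull.exists_isRestrictionMap`,
  `IsStarHull.exists_hasRestrictionDeriv_holds` (restriction data `(Φ_A, Φ'_A(0))` exist) — all PROVED.

## The cut: 5/8 restriction law (conformal content) + simplicity (lattice estimate) + passage (soft)

* S1 `stub_hexRestrictionLaw` (HARDEST; the conformal content, where `5/8` enters) — THE LSW RESTRICTION
  LAW FOR THE CRITICAL HEXAGONAL SAW: for every Dobrushin `D`, hull subdomain `D'` (`D' ⊆ D`, same marked
  points, agreeing with `D` in ε-balls around them), hexagonal endpoint approximation, chordal uniformizer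
  `φ : ℍ → D` and restriction data `(Φ, d = Φ'_A(0))` of `A = φ.pullbackHull D'`,
  `P^{Hex}_δ(range γ_δ ⊆ closure D') → d^{5/8}` as `δ → 0⁺`. VERBATIM the typed item
  stmt-CriticalPhenomena-7147 (`SAWLatticeVirasoro.HexRestrictionLaw`, the hex twin of
  `SAWLoopFugacityFlow.AvoidanceLimit` stmt-4981) — one statement, staffed once, simulable by refuters.
  Lattice meaning: `Z_δ(Ω'_δ; a, b)/Z_δ(Ω_δ; a, b) → Φ'_A(0)^{5/8}` (exact domain-restriction property of the
  `x_c`-weights, up to boundary-touching walks); `5/8 = x̃₁ = h_{2,1}` is the boundary one-leg exponent the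
  route computes by Bethe ansatz (r2 `StripGapFiveEighths`), `1 − 2·(5/8) = −1/4` the bridge exponent of
  `BridgeExponentQuarter`. Size: open-problem (no exponent is a theorem on any lattice).
* S2 `stub_hexSimpleSubseqLimits` — SUBSEQUENTIAL LIMITS ARE CARRIED BY SIMPLE BOUNDARY-AVOIDING CHORDS:
  under the crux's own hypotheses, `ν`-a.e. curve class is simple, runs from `a` to `b`, has range in
  `closure D` and meets `∂D` only at `a, b` (the carrier clause of `AvoidanceDeterminesLaw`). VERBATIM item
  stmt-CriticalPhenomena-7148 (`SAWLatticeVirasoro.HexSimpleSubseqLimits`; hex twin of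
  `SAWLoopFugacityFlow.SimpleSubseqLimits` stmt-4982, which has a live `Theorems/SAWLoopFugacityFlowSimpleSubseqLimits*`
  programme on `ℤ²` to port). A uniform-in-mesh lattice estimate (no macroscopic near-self-touching, no
  boundary crawling at `x_c`): `CurveClass.simple` is not closed, nothing soft gives it. Size L–XL.
* S3 `stub_hexAvoidancePassage` — THE PORTMANTEAU SANDWICH ON HEX: if `ν` is the weak limit along `s_n`,
  `μ` is an SLE_{8/3} law of `D`, and along `s_n` the lattice avoidance probabilities of EVERY hull
  subdomain `D''` converge to `μ(range ⊆ closure D'')`, then `ν(range ⊆ closure D') = μ(range ⊆ closure D')`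
  for every hull subdomain `D'`. VERBATIM item stmt-CriticalPhenomena-7149
  (`SAWLatticeVirasoro.HexAvoidancePassage`); its `ℤ²` twin stmt-4984 is PROVED
  (`Theorems/SAWLoopFugacityFlowAvoidancePassage.lean`, `avoidancePassage_proof`: closed event for `≤`,
  carved hull super-domains `AvoidancePassage.exists_superdomain` + open events for `≥`); the only
  lattice-specific inputs there are "the law has mass 0 or 1" and "lattice curves live in `closure D`",
  both true for `hexSAWLaw` / `EmbDomainSAW.curve`. Size M, provable now by porting.

`HexSubseqIdentification_of` (kernel-checked, no `sorry` of its own, ~35 lines) is a genuine composition,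
not a seam: realise the SLE_{8/3} law `μ` of `D` (`exists_isSLECurve_eightThirds`), take its carrier
(`SLECarrier_proof`) and the carrier of `ν` (S2); pick a chordal uniformizer `φ`
(`exists_isChordalUniformizing_holds`); for every hull subdomain `D'` produce the `*`-hull
`A = φ.pullbackHull D'` (`isHullSubdomain_of_conds`, `IsStarHull.pullbackHull`), a restriction map `Φ`
and its derivative `d` (`exists_isRestrictionMap`, `exists_hasRestrictionDeriv_holds`), so that S1 composed
with `s_n → 0⁺` and `SLEAvoidanceValue_pullbackHull_proof` give `P_n(range ⊆ cl D') → d^{5/8} = μ(range ⊆ cl D')`;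
S3 turns this into `ν = μ` on all hull-avoidance events; `AvoidanceDeterminesLaw_proof` gives `ν = μ`,
whence `IsSLELaw (8/3) D ν`. Hypotheses = the three stubs under their registered names
(`__Registered.stub_…`, see below); conclusion = the route decl BY NAME.

What the cut buys and what it bets. Every stub is (modulo the sibling crux `HexEventualTight` for S1's
full-filter form) a CONSEQUENCE of the crux: S2 ⇐ crux + `SLECarrier`; S3's conclusion ⇐ crux + uniqueness
of the SLE law (`IsSLELaw.unique`); S1 ⇐ (crux + tightness ⇒ full convergence) + the open-event sandwich +
`HullRestrictionNull`. So nothing is lost, and the difficulty is split into two named, independently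
attackable pieces of different nature — the NUMBER `5/8` (S1: any hex method: parafermion + restriction,
lattice Virasoro/Ward, or the route's Bethe-ansatz exponents fed through an avoidance/bridge dictionary)
and the REGULARITY of limits (S2) — plus one provable-now passage (S3). If S1 is attacked AS TYPED only
through non-existence of the full-filter limit for pathological endpoint approximations, the local reshape
is its sequential weakening "if the pushed-forward laws converge weakly to a probability `ν` along `s_n`
then `P_{s_n}(range ⊆ cl D') → d^{5/8}`", which `HexSubseqIdentification_of` uses verbatim (it only ever
composes S1 with `s`).

Disproof used: none relevant — `ledger crux ls stmt-CriticalPhenomena-4998`: no workfiles before this one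
(no `Disproof.lean`, no `_false_without_` theorem, 2026-08-17). Negatives index (CriticalPhenomena,
2026-08-17): the refuted ALL-`δ` tightness stmt-CriticalPhenomena-0772 is not approached (S1 converges
along `𝓝[>] 0` where `IsEmbEndpointApprox` binds; S2/S3 only along `s_n → 0⁺`); no negative entry is an
avoidance-probability or carrier statement on Hex.
-/

noncomputable section

open MeasureTheory Filter Topology Set
open scoped NNReal ENNReal
open UpperHalfPlane (upperHalfPlaneSet)
open Literature.Probability.RandomPlanarGeometry Literature.Probability.LatticeModels

namespace Summit.CriticalPhenomena.SAWScalingLimit.Cruxes.HexSubseqIdentification.Birth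

/-! ### Vocabulary of the line: the three statements, named -/

/-- **S1, named.** The Lawler–Schramm–Werner restriction law with exponent `5/8` for the critical
hexagonal SAW (verbatim item stmt-CriticalPhenomena-7147, `SAWLatticeVirasoro.HexRestrictionLaw`). -/
def HexRestrictionLaw58 : Prop :=
  ∀ (D D' : DobrushinDomain) (a b : ℝ → HexVertex), SAW.IsEmbEndpointApprox hexGraph hexCenter D a b →
    D'.carrier ⊆ D.carrier → D'.pt 0 = D.pt 0 → D'.pt 1 = D.pt 1 →
    (∃ ε : ℝ, 0 < ε ∧ D'.carrier ∩ Metric.ball (D.pt 0) ε = D.carrier ∩ Metric.ball (D.pt 0) ε ∧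
      D'.carrier ∩ Metric.ball (D.pt 1) ε = D.carrier ∩ Metric.ball (D.pt 1) ε) →
    ∀ (φ : ConformalEquiv upperHalfPlaneSet D.carrier), D.IsChordalUniformizing φ →
    ∀ (Φ : ConformalEquiv (upperHalfPlaneSet \ φ.pullbackHull D') upperHalfPlaneSet) (d : ℝ),
      IsRestrictionMap (φ.pullbackHull D') Φ → HasRestrictionDeriv (φ.pullbackHull D') Φ d →
      Tendsto (fun δ => ((SAW.hexSAWLaw D.carrier δ (a δ) (b δ)).map (fun γ => γ.curve))
          (CurveClass.rangeSubset (closure D'.carrier)))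
        (𝓝[>] (0 : ℝ)) (𝓝 (ENNReal.ofReal (d ^ ((5 : ℝ) / 8))))

/-- **S2, named.** Subsequential weak limits of the critical hexagonal SAW laws are carried by simple
boundary-avoiding chords (verbatim item stmt-CriticalPhenomena-7148, `SAWLatticeVirasoro.HexSimpleSubseqLimits`). -/
def HexSimpleSubseqLimits : Prop :=
  ∀ (D : DobrushinDomain) (a b : ℝ → HexVertex), SAW.IsEmbEndpointApprox hexGraph hexCenter D a b →
    ∀ (s : ℕ → ℝ) (ν : Measure (CurveClass ℂ)), Tendsto s atTop (𝓝[>] (0 : ℝ)) →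
      IsProbabilityMeasure ν →
      (∀ f : BoundedContinuousFunction (CurveClass ℂ) ℝ,
        Tendsto (fun n => ∫ γ, f γ.curve ∂(SAW.hexSAWLaw D.carrier (s n) (a (s n)) (b (s n))))
          atTop (𝓝 (∫ x, f x ∂ν))) →
      ∀ᵐ γ ∂ν, γ ∈ CurveClass.simple ∧ γ.source = D.pt 0 ∧ γ.target = D.pt 1 ∧
        γ.range ⊆ closure D.carrier ∧ γ.range ∩ frontier D.carrier ⊆ {D.pt 0, D.pt 1}

/-- **S3, named.** The portmanteau sandwich on Hex: convergence of all hull-subdomain avoidance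
probabilities to the values of an SLE_{8/3} law `μ` forces the subsequential limit `ν` to agree with `μ`
on every hull-avoidance event (verbatim item stmt-CriticalPhenomena-7149, `SAWLatticeVirasoro.HexAvoidancePassage`). -/
def HexAvoidancePassage : Prop :=
  ∀ (D : DobrushinDomain) (a b : ℝ → HexVertex), SAW.IsEmbEndpointApprox hexGraph hexCenter D a b →
    ∀ (s : ℕ → ℝ) (ν μ : Measure (CurveClass ℂ)), Tendsto s atTop (𝓝[>] (0 : ℝ)) →
      IsProbabilityMeasure ν →
      (∀ f : BoundedContinuousFunction (CurveClass ℂ) ℝ,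
        Tendsto (fun n => ∫ γ, f γ.curve ∂(SAW.hexSAWLaw D.carrier (s n) (a (s n)) (b (s n))))
          atTop (𝓝 (∫ x, f x ∂ν))) →
      IsSLELaw ((8 : ℝ≥0) / 3) D μ →
      (∀ D' : DobrushinDomain, D'.carrier ⊆ D.carrier → D'.pt 0 = D.pt 0 → D'.pt 1 = D.pt 1 →
        (∃ ε : ℝ, 0 < ε ∧ D'.carrier ∩ Metric.ball (D.pt 0) ε = D.carrier ∩ Metric.ball (D.pt 0) ε ∧
          D'.carrier ∩ Metric.ball (D.pt 1) ε = D.carrier ∩ Metric.ball (D.pt 1) ε) →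
        Tendsto (fun n => ((SAW.hexSAWLaw D.carrier (s n) (a (s n)) (b (s n))).map (fun γ => γ.curve))
            (CurveClass.rangeSubset (closure D'.carrier)))
          atTop (𝓝 (μ (CurveClass.rangeSubset (closure D'.carrier))))) →
      ∀ D' : DobrushinDomain, D'.carrier ⊆ D.carrier → D'.pt 0 = D.pt 0 → D'.pt 1 = D.pt 1 →
        (∃ ε : ℝ, 0 < ε ∧ D'.carrier ∩ Metric.ball (D.pt 0) ε = D.carrier ∩ Metric.ball (D.pt 0) ε ∧
          D'.carrier ∩ Metric.ball (D.pt 1) ε = D.carrier ∩ Metric.ball (D.pt 1) ε) →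
        ν (CurveClass.rangeSubset (closure D'.carrier)) = μ (CurveClass.rangeSubset (closure D'.carrier))

/-! ### The stubs (the ONLY `sorry`s of this file)

Each stub is stated over TREE VOCABULARY ONLY (the named statements above, unfolded by hand), so that it
lands verbatim as a `Theorems/…` file `--supports stmt-CriticalPhenomena-4998` without importing this
workfile; the `*_holds` theorems below certify definitionally that the unfolded text IS the named statement;
the docstrings record the shared ledger items (stmt-7147/7148/7149). Provers landing a
stub need `open MeasureTheory Filter Topology Set UpperHalfPlane Literature.Probability.RandomPlanarGeometry
Literature.Probability.LatticeModels` and `open scoped NNReal ENNReal` for the registered signature text to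
elaborate verbatim. -/

/-- **S1 (hardest) — the `5/8` restriction law for the critical hexagonal SAW** (LSW03
arXiv:math/0209343 Thm. 6.1 p. 23 predicts the value; LSW04 arXiv:math/0204277 §3.4.5 p. 14 the lattice
restriction property; DCS12 arXiv:1007.0575 Conj. 1–2). For every Dobrushin `D`, hull subdomain `D'`
(ε-ball form), hexagonal endpoint approximation `(a_δ, b_δ)`, chordal uniformizer `φ` and restriction data
`(Φ, d)` of `φ.pullbackHull D'`: `P^{Hex}_δ(range ⊆ closure D') → ENNReal.ofReal (d ^ (5/8))` as `δ → 0⁺`.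
Verbatim item stmt-CriticalPhenomena-7147. This is where the route's independently computed boundary
exponent `x̃₁ = 5/8` (r2 `StripGapFiveEighths`) is load-bearing. -/
theorem stub_hexRestrictionLaw :
    ∀ (D D' : DobrushinDomain) (a b : ℝ → HexVertex), SAW.IsEmbEndpointApprox hexGraph hexCenter D a b →
      D'.carrier ⊆ D.carrier → D'.pt 0 = D.pt 0 → D'.pt 1 = D.pt 1 →
      (∃ ε : ℝ, 0 < ε ∧ D'.carrier ∩ Metric.ball (D.pt 0) ε = D.carrier ∩ Metric.ball (D.pt 0) ε ∧
        D'.carrier ∩ Metric.ball (D.pt 1) ε = D.carrier ∩ Metric.ball (D.pt 1) ε) →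
      ∀ (φ : ConformalEquiv upperHalfPlaneSet D.carrier), D.IsChordalUniformizing φ →
      ∀ (Φ : ConformalEquiv (upperHalfPlaneSet \ φ.pullbackHull D') upperHalfPlaneSet) (d : ℝ),
        IsRestrictionMap (φ.pullbackHull D') Φ → HasRestrictionDeriv (φ.pullbackHull D') Φ d →
        Tendsto (fun δ => ((SAW.hexSAWLaw D.carrier δ (a δ) (b δ)).map (fun γ => γ.curve))
            (CurveClass.rangeSubset (closure D'.carrier)))
          (𝓝[>] (0 : ℝ)) (𝓝 (ENNReal.ofReal (d ^ ((5 : ℝ) / 8)))) := by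
  sorry

/-- **S2 — subsequential limits of the critical hexagonal SAW are carried by simple chords from `a` to
`b` meeting `∂D` only at `a, b`** (LSW04 arXiv:math/0204277 §3.4.5; Kennedy–Lawler arXiv:1109.3091;
only sub-ballisticity is in print, Duminil-Copin–Hammond 2013 / arXiv:2310.17299). A uniform-in-mesh
no-near-self-touching / no-boundary-crawling estimate at `x_c`; `CurveClass.simple` is not a closed event,
so nothing soft gives it. Verbatim item stmt-CriticalPhenomena-7148 (hex twin of stmt-4982, whose `ℤ²`
programme `Theorems/SAWLoopFugacityFlowSimpleSubseqLimits*` is the thing to port). -/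
theorem stub_hexSimpleSubseqLimits :
    ∀ (D : DobrushinDomain) (a b : ℝ → HexVertex), SAW.IsEmbEndpointApprox hexGraph hexCenter D a b →
      ∀ (s : ℕ → ℝ) (ν : Measure (CurveClass ℂ)), Tendsto s atTop (𝓝[>] (0 : ℝ)) →
        IsProbabilityMeasure ν →
        (∀ f : BoundedContinuousFunction (CurveClass ℂ) ℝ,
          Tendsto (fun n => ∫ γ, f γ.curve ∂(SAW.hexSAWLaw D.carrier (s n) (a (s n)) (b (s n))))
            atTop (𝓝 (∫ x, f x ∂ν))) →
        ∀ᵐ γ ∂ν, γ ∈ CurveClass.simple ∧ γ.source = D.pt 0 ∧ γ.target = D.pt 1 ∧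
          γ.range ⊆ closure D.carrier ∧ γ.range ∩ frontier D.carrier ⊆ {D.pt 0, D.pt 1} := by
  sorry

/-- **S3 — the portmanteau sandwich on Hex** (provable now: port `Theorems/SAWLoopFugacityFlowAvoidancePassage.lean`,
the PROVED `ℤ²` twin stmt-4984 — `≤` on the closed event `rangeSubset (closure D')`
(`CurveClass.isClosed_rangeSubset`, Mathlib portmanteau for the eventually-probability laws), `≥` through
carved hull super-domains `AvoidancePassage.exists_superdomain` and the open events `rangeSubset Tᶜ`, using
only that `hexSAWLaw` has mass `0` or `1` and that hexagonal lattice curves live in `closure D`).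
Verbatim item stmt-CriticalPhenomena-7149. -/
theorem stub_hexAvoidancePassage :
    ∀ (D : DobrushinDomain) (a b : ℝ → HexVertex), SAW.IsEmbEndpointApprox hexGraph hexCenter D a b →
      ∀ (s : ℕ → ℝ) (ν μ : Measure (CurveClass ℂ)), Tendsto s atTop (𝓝[>] (0 : ℝ)) →
        IsProbabilityMeasure ν →
        (∀ f : BoundedContinuousFunction (CurveClass ℂ) ℝ,
          Tendsto (fun n => ∫ γ, f γ.curve ∂(SAW.hexSAWLaw D.carrier (s n) (a (s n)) (b (s n))))
            atTop (𝓝 (∫ x, f x ∂ν))) →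
        IsSLELaw ((8 : ℝ≥0) / 3) D μ →
        (∀ D' : DobrushinDomain, D'.carrier ⊆ D.carrier → D'.pt 0 = D.pt 0 → D'.pt 1 = D.pt 1 →
          (∃ ε : ℝ, 0 < ε ∧ D'.carrier ∩ Metric.ball (D.pt 0) ε = D.carrier ∩ Metric.ball (D.pt 0) ε ∧
            D'.carrier ∩ Metric.ball (D.pt 1) ε = D.carrier ∩ Metric.ball (D.pt 1) ε) →
          Tendsto (fun n => ((SAW.hexSAWLaw D.carrier (s n) (a (s n)) (b (s n))).map (fun γ => γ.curve))
              (CurveClass.rangeSubset (closure D'.carrier)))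
            atTop (𝓝 (μ (CurveClass.rangeSubset (closure D'.carrier))))) →
        ∀ D' : DobrushinDomain, D'.carrier ⊆ D.carrier → D'.pt 0 = D.pt 0 → D'.pt 1 = D.pt 1 →
          (∃ ε : ℝ, 0 < ε ∧ D'.carrier ∩ Metric.ball (D.pt 0) ε = D.carrier ∩ Metric.ball (D.pt 0) ε ∧
            D'.carrier ∩ Metric.ball (D.pt 1) ε = D.carrier ∩ Metric.ball (D.pt 1) ε) →
          ν (CurveClass.rangeSubset (closure D'.carrier)) =
            μ (CurveClass.rangeSubset (closure D'.carrier)) := by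
  sorry

/-! ### Consistency: each named statement IS its registered stub (definitionally) -/

theorem hexRestrictionLaw58_holds : HexRestrictionLaw58 := stub_hexRestrictionLaw
theorem hexSimpleSubseqLimits_holds : HexSimpleSubseqLimits := stub_hexSimpleSubseqLimits
theorem hexAvoidancePassage_holds : HexAvoidancePassage := stub_hexAvoidancePassage

/-! ### Name-keyed aliases of the three statements — the hypotheses of `HexSubseqIdentification_of`

The native skeleton audit (`#h21_check_skeleton`) admits a hypothesis of the skeleton theorem only if its head
constant is a registered obligation or is NAMED like a declared stub; `__Registered.stub_X` is the statement of
`stub_X` under that name (device of `Cruxes/AxiomsOfLimit/Lines/birth.lean`: the `__` namespace is an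
implementation detail, so the audit's stub report resolves each `stub_…` to the sorried theorem, not to the
alias; the gate-reserved `@[stub]` attribute is not written by a planner). Each alias is `rfl`-equal to its
statement. -/
namespace __Registered

/-- Alias of `HexRestrictionLaw58` keyed by the registered stub name. -/
abbrev stub_hexRestrictionLaw : Prop := HexRestrictionLaw58
/-- Alias of `HexSimpleSubseqLimits` keyed by the registered stub name. -/
abbrev stub_hexSimpleSubseqLimits : Prop := HexSimpleSubseqLimits
/-- Alias of `HexAvoidancePassage` keyed by the registered stub name. -/
abbrev stub_hexAvoidancePassage : Prop := HexAvoidancePassage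

end __Registered

/-! ### The skeleton theorem: the three stubs imply the crux, BY NAME -/

/-- **`HexSubseqIdentification` from the line `birth`** (kernel-checked, no `sorry` of its own): realise
the chordal SLE_{8/3} law `μ` of `(D; a, b)` and its simple-chord carrier; take the carrier of the
subsequential limit `ν` from S2; fix a chordal uniformizer `φ`; for every hull subdomain `D'` build the
`*`-hull `φ.pullbackHull D'` with restriction data `(Φ, d)` and combine S1 (composed with `s_n → 0⁺`) with
the SLE value `μ(range ⊆ cl D') = d^{5/8}` to get convergence of the lattice avoidance probabilities to the
SLE values; S3 upgrades this to `ν = μ` on all hull-avoidance events, and avoidance determines the law: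
`ν = μ`, an SLE_{8/3} law. Hypotheses = the three stubs, under their registered names; conclusion = the
route decl, by name. -/
theorem HexSubseqIdentification_of (hR : __Registered.stub_hexRestrictionLaw)
    (hS : __Registered.stub_hexSimpleSubseqLimits) (hP : __Registered.stub_hexAvoidancePassage) :
    Summit.CriticalPhenomena.SAWScalingLimit.Theses.SAWBetheAnsatz.HexSubseqIdentification := by
  intro D a b hab s ν hs hν hlim
  classical
  -- the chordal SLE_{8/3} law `μ` of `(D; a, b)` (existence PROVED: Rohde–Schramm trace + transience)
  obtain ⟨μ, hμ⟩ : ∃ μ : Measure (CurveClass ℂ), IsSLELaw ((8 : ℝ≥0) / 3) D μ := by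
    obtain ⟨Γ, hΓ⟩ := exists_isSLECurve_eightThirds D
    exact ⟨_, hΓ.isSLELaw_map⟩
  -- its carrier (PROVED support item stmt-4985) and the carrier of `ν` (stub S2)
  obtain ⟨hμP, hμcar⟩ :=
    _root_.Summit.CriticalPhenomena.SAWScalingLimit.Theorems.SLECarrier_proof D μ hμ
  have hνcar : ∀ᵐ γ ∂ν, γ ∈ CurveClass.simple ∧ γ.source = D.pt 0 ∧ γ.target = D.pt 1 ∧
      γ.range ⊆ closure D.carrier ∧ γ.range ∩ frontier D.carrier ⊆ {D.pt 0, D.pt 1} :=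
    hS D a b hab s ν hs hν hlim
  -- a chordal uniformizing map `φ : (ℍ; 0, ∞) → (D; a, b)` (Riemann + Carathéodory, PROVED)
  obtain ⟨φ, hφ⟩ := MarkedDomain.exists_isChordalUniformizing_holds D
  -- along `s`, the lattice avoidance probability of every hull subdomain tends to its SLE_{8/3} value
  have hconv : ∀ D' : DobrushinDomain, D'.carrier ⊆ D.carrier → D'.pt 0 = D.pt 0 → D'.pt 1 = D.pt 1 →
      (∃ ε : ℝ, 0 < ε ∧ D'.carrier ∩ Metric.ball (D.pt 0) ε = D.carrier ∩ Metric.ball (D.pt 0) ε ∧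
        D'.carrier ∩ Metric.ball (D.pt 1) ε = D.carrier ∩ Metric.ball (D.pt 1) ε) →
      Tendsto (fun n => ((SAW.hexSAWLaw D.carrier (s n) (a (s n)) (b (s n))).map (fun γ => γ.curve))
          (CurveClass.rangeSubset (closure D'.carrier)))
        atTop (𝓝 (μ (CurveClass.rangeSubset (closure D'.carrier)))) := by
    intro D' hsub h0 h1 hε
    -- `D'` is a hull subdomain, so `A = φ.pullbackHull D'` is a `*`-hull with restriction data `(Φ, d)`
    have hHull : D.IsHullSubdomain D' :=
      _root_.Summit.CriticalPhenomena.SAWScalingLimit.Theorems.IsingBoundaryRatio.Negative.isHullSubdomain_of_conds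
        hsub h0 h1 hε
    have hA : IsStarHull (φ.pullbackHull D') :=
      IsStarHull.pullbackHull JordanDomain.isSimplyConnected_holds hφ hHull
    obtain ⟨Φ, hΦ⟩ := hA.exists_isRestrictionMap
    obtain ⟨d, -, -, hd⟩ := IsStarHull.exists_hasRestrictionDeriv_holds hA hΦ
    -- S1 along the full filter `𝓝[>] 0`, and the SLE_{8/3} value (PROVED support item stmt-4986)
    have hlat := hR D D' a b hab hsub h0 h1 hε φ hφ Φ d hΦ hd
    have hval : μ (CurveClass.rangeSubset (closure D'.carrier)) = ENNReal.ofReal (d ^ ((5 : ℝ) / 8)) :=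
      _root_.Summit.CriticalPhenomena.SAWScalingLimit.Theorems.SLEAvoidanceValue_pullbackHull_proof
        D D' μ hμ hsub h0 h1 hε φ hφ Φ d hΦ hd
    rw [hval]
    exact hlat.comp hs
  -- S3: `ν` and `μ` agree on every hull-avoidance event
  have hagree := hP D a b hab s ν μ hs hν hlim hμ hconv
  -- avoidance determines the law (PROVED support item stmt-1373): `ν = μ`
  have heq : ν = μ :=
    _root_.Summit.CriticalPhenomena.SAWScalingLimit.Theorems.AvoidanceDeterminesLaw.AvoidanceDeterminesLaw_proof
      D ν μ hν hμP hνcar hμcar hagree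
  rw [heq]
  exact hμ

/-- Wiring check (an `example`, so that `HexSubseqIdentification_of` stays the only theorem concluding the
crux): the registered stubs, with their tree-vocabulary types, feed the skeleton theorem as stated — this term
becomes the crux proof when the three `sorry`s above are discharged. -/
example : Summit.CriticalPhenomena.SAWScalingLimit.Theses.SAWBetheAnsatz.HexSubseqIdentification :=
  HexSubseqIdentification_of stub_hexRestrictionLaw stub_hexSimpleSubseqLimits stub_hexAvoidancePassage

end Summit.CriticalPhenomena.SAWScalingLimit.Cruxes.HexSubseqIdentification.Birth

end
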